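import Summits.PneNP.PneNP.Theorems.ExpanderLinearGeneratorsNoPolyBoundedProofSystem
import Literature.Computability.Complexity.ScaledKannanDiagonal

/-!
# Route ProofCplx / ExpanderLinearGenerators — the scaled Kannan diagonal language at the
# quarter-exponential scale has circuit complexity `≥ 2^{n/8}` (bootstrap, item `stmt-PneNP-0097`)

Helper file for the line `Sketch` (bootstrap composition, Krajíček 2004, Fund. Math. 182,
Thm. 3.1(ii)) of the crux `ProofcplxThesis` / `NoPolyBoundedProofSystem` (item `stmt-PneNP-0097`,
`≡ NP ≠ coNP` by `noPolyBoundedProofSystem_iff_NP_ne_coNP`). The scaled Kannan diagonal language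
`KannanScaled.diag N = {y | pad (N |y|) y ∈ Kannan.lang 0}` (`ScaledKannanDiagonal.lean`,
Murray–Williams 2018, Thm. 2.3, via Kannan 1982, Lemma 1) is read at the quarter-exponential scale

  `N(n) = 2^{h+2} + (h + 2) + 1`,  `h = ⌊⌊n/2⌋/2⌋ = ⌊n/4⌋`.

* `eventually_le_circuitSize_diag_quarter`: for all large `n`,
  `2^{n/8} ≤ circuitSize (KannanScaled.diag N) n` (as reals).

Proof: write `h = k + 2` and `s = 2^k`, so that `N(n) = 16 s + k + 5` (`diagQuarterScale_eq`);
the side conditions of the proved engine `KannanScaled.lt_circuitSize_diag` hold —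
`n ≤ 4k + 11 ≤ N(n)`; the description budget `(s+1)(8(N(n)+s)+10) ≤ N(n)²`
(`diagQuarterScale_budget_le`); `N(n)² + 1 ≤ 2^{N(n)}` for large `N(n) ≥ n`
(`Kannan.eventually_pow_succ_le_two_pow 2`); and `N(n) < 2^{k+5}`
(`diagQuarterScale_lt_two_pow`), so `N(n)² < 2^{2k+10} ≤ 2ⁿ` because `4k + 8 ≤ n` — whence
`2^k < circuitSize (diag N) n`, and `n/8 ≤ k` once `n ≥ 20` (`n ≤ 4k + 11`). Pure arithmetic
over two proved tree theorems; no named fact is introduced.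

Sources: R. Kannan, *Circuit-size lower bounds and non-reducibility to sparse sets*, Inform.
Control 55 (1982) 40–56, Lemma 1; C. D. Murray, R. R. Williams, *Circuit lower bounds for
nondeterministic quasi-polytime*, STOC 2018, Thm. 2.3; J. Krajíček, *Diagonalization in proof
complexity*, Fund. Math. 182 (2004) 181–192, Thm. 3.1(ii).
-/

set_option linter.dupNamespace false -- `Summit.PneNP.PneNP.…`: summit = sub-problem name (D-0017 single-conjunct layout)

namespace Summit.PneNP.PneNP.Theorems.Bootstrap

open Filter
open Literature.Computability.Complexity Literature.Computability.MetaComplexity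
open Summit.PneNP.PneNP.Theses

/-- The quarter scale in closed form: `2^{(k+2)+2} + ((k+2)+2) + 1 = 16 · 2^k + k + 5`.
[folklore] -/
theorem diagQuarterScale_eq (k : ℕ) : 2 ^ (k + 2 + 2) + (k + 2 + 2) + 1 = 16 * 2 ^ k + k + 5 := by
  ring

/-- The description budget at the quarter scale: with `s ≥ 1` and `N = 16 s + k + 5`,
`(s+1)(8(N+s)+10) ≤ N²` (indeed
`N² - (s+1)(8(N+s)+10) = 120 s² + 24 k s - 26 s + k² + 2k - 25 > 0`). [folklore] -/
theorem diagQuarterScale_budget_le (s k : ℕ) (hs : 1 ≤ s) :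
    (s + 1) * (8 * (16 * s + k + 5 + s) + 10) ≤ (16 * s + k + 5) ^ 2 := by
  nlinarith [hs, Nat.zero_le k, Nat.zero_le (k * s)]

/-- The quarter scale is below `2^{k+5}`: `16 · 2^k + k + 5 < 32 · 2^k` as `k < 2^k`.
[folklore] -/
theorem diagQuarterScale_lt_two_pow (k : ℕ) : 16 * 2 ^ k + k + 5 < 2 ^ (k + 5) := by
  have hk : k < 2 ^ k := Nat.lt_two_pow_self
  have h32 : 2 ^ (k + 5) = 32 * 2 ^ k := by ring
  omega

/-- **Bootstrap lower bound** (Krajíček 2004, Thm. 3.1(ii), hardness half, via Kannan's least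
hard table). The scaled Kannan diagonal language at the quarter-exponential scale
`N(n) = 2^{⌊⌊n/2⌋/2⌋+2} + ⌊⌊n/2⌋/2⌋ + 3` has circuit complexity `≥ 2^{n/8}` at every large
length: the three side conditions of `KannanScaled.lt_circuitSize_diag` (Murray–Williams 2018,
Thm. 2.3) hold at `s = 2^{⌊n/4⌋-2}`, and `n/8 ≤ ⌊n/4⌋ - 2` for `n ≥ 20`.
[cite: Kannan1982, Lemma 1] -/
theorem eventually_le_circuitSize_diag_quarter :
    ∀ᶠ n : ℕ in atTop, (2 : ℝ) ^ ((1 / 8 : ℝ) * n) ≤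
      ((KannanScaled.diag (fun n => 2 ^ (n / 2 / 2 + 2) + (n / 2 / 2 + 2) + 1)).circuitSize n : ℝ) := by
  obtain ⟨M₀, hM₀⟩ := eventually_atTop.1 (Kannan.eventually_pow_succ_le_two_pow 2)
  filter_upwards [eventually_ge_atTop (max M₀ 20)] with n hn
  have hM : M₀ ≤ n := (le_max_left _ _).trans hn
  have h20 : 20 ≤ n := (le_max_right _ _).trans hn
  -- `⌊⌊n/2⌋/2⌋ = k + 2` with `3 ≤ k`, so `4k + 8 ≤ n ≤ 4k + 11 ≤ 8k`
  obtain ⟨k, hk⟩ : ∃ k, n / 2 / 2 = k + 2 := ⟨n / 2 / 2 - 2, by omega⟩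
  have hn8 : n ≤ 8 * k := by omega
  -- the scale in closed form, `s = 2^k ≥ 1`, `k < 2^k`
  have hN : 2 ^ (n / 2 / 2 + 2) + (n / 2 / 2 + 2) + 1 = 16 * 2 ^ k + k + 5 := by
    rw [hk]
    exact diagQuarterScale_eq k
  have hs : 1 ≤ 2 ^ k := Nat.one_le_two_pow
  have hklt : k < 2 ^ k := Nat.lt_two_pow_self
  -- (hnN) `n ≤ N(n)`
  have hnN : n ≤ 2 ^ (n / 2 / 2 + 2) + (n / 2 / 2 + 2) + 1 := by
    rw [hN]
    omega
  -- (hA) the descriptions of size-`2^k` circuits on `N(n)` inputs fit Kannan's budget `N(n)²`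
  have hA : (2 ^ k + 1) * (8 * (2 ^ (n / 2 / 2 + 2) + (n / 2 / 2 + 2) + 1 + 2 ^ k) + 10) ≤
      (2 ^ (n / 2 / 2 + 2) + (n / 2 / 2 + 2) + 1) ^ 2 := by
    rw [hN]
    exact diagQuarterScale_budget_le (2 ^ k) k hs
  -- (hB) a hard table exists at length `N(n) ≥ n ≥ M₀`
  have hB : (2 ^ (n / 2 / 2 + 2) + (n / 2 / 2 + 2) + 1) ^ 2 + 1 ≤
      2 ^ (2 ^ (n / 2 / 2 + 2) + (n / 2 / 2 + 2) + 1) :=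
    hM₀ _ (hM.trans hnN)
  -- (hC) every live address is `n`-bit: `N(n)² < 2^{2k+10} ≤ 2ⁿ`
  have hC : (2 ^ (n / 2 / 2 + 2) + (n / 2 / 2 + 2) + 1) ^ 2 < 2 ^ n := by
    rw [hN]
    calc (16 * 2 ^ k + k + 5) ^ 2 < (2 ^ (k + 5)) ^ 2 :=
          Nat.pow_lt_pow_left (diagQuarterScale_lt_two_pow k) (by norm_num)
      _ = 2 ^ ((k + 5) * 2) := (pow_mul 2 (k + 5) 2).symm
      _ ≤ 2 ^ n := Nat.pow_le_pow_right two_pos (by omega)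
  -- the engine: `2^k < circuitSize (diag N) n`
  have hlt : 2 ^ k < (KannanScaled.diag
      (fun n => 2 ^ (n / 2 / 2 + 2) + (n / 2 / 2 + 2) + 1)).circuitSize n :=
    KannanScaled.lt_circuitSize_diag
      (N := fun n => 2 ^ (n / 2 / 2 + 2) + (n / 2 / 2 + 2) + 1) hnN hA hB hC
  -- over `ℝ`: `2^{n/8} ≤ 2^k ≤ circuitSize (diag N) n`
  have hexp : (1 / 8 : ℝ) * n ≤ (k : ℝ) := by
    have h8 : (n : ℝ) ≤ 8 * k := by exact_mod_cast hn8
    linarith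
  calc (2 : ℝ) ^ ((1 / 8 : ℝ) * n) ≤ (2 : ℝ) ^ (k : ℝ) :=
        Real.rpow_le_rpow_of_exponent_le (by norm_num) hexp
    _ ≤ _ := by
        rw [Real.rpow_natCast]
        exact_mod_cast hlt.le

end Summit.PneNP.PneNP.Theorems.Bootstrap
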